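import Summits.BirchSwinnertonDyer.BirchSwinnertonDyer.Theses.ResidualThetaTransportAtTwo
import Summits.BirchSwinnertonDyer.BirchSwinnertonDyer.Theorems.UniversalToricDescentLocalH1Corank
import Summits.BirchSwinnertonDyer.BirchSwinnertonDyer.Theorems.ResidualThetaTransportAtTwoResidualSignedLambdaLowerCMAtTwoCofreeTorsionFinite
import HarnessLib

/-!
# Sketch (stub-ideation k2 g8) — `stub_cmLambdaLower`, clause S1⊕ (count + finiteness of the S₀-block)

Typed sketch for the idea card `stub-cmlambdalower-k2-g8` (crux item stmt-BirchSwinnertonDyer-26074,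
stub `stub_cmLambdaLower` = route decl `ResidualSignedLambdaLowerCMAtTwo`, stmt-22608).

§A (PROVED, pure algebra): the `p = 2` "even-trace collapse" — a `2 × 2` matrix with trace `≡ 0` and
determinant `≡ 1` modulo an ideal `I ∋ 2` squares to `1 mod I`, and then `M ^ (2 ^ R) ≡ 1 mod I ^ R`.
This is the input that makes the Greenberg–Vatsal / UTD fixed-point count at a place `ℓ ∤ 2M` with
`‖a_ℓ(g)‖ < 1` equal to ALL of `A_ρ[ϖ^m]`.

§B (SIGNATURES ONLY, as `Prop`s — nothing asserted, no `sorry`): the helper statements H2–H5 of the card,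
typed over existing tree declarations (UTD lane `UniversalToricDescent*`, `GreenbergSelmer.Cofree`,
`X11b.Coinv.kerD`, `GreenbergSelmer.scalarH1`, `CharacterModule`).

BSD is NOT proved by any of this; nothing here is a tree proposal.
-/

set_option autoImplicit false
set_option linter.dupNamespace false

noncomputable section

open scoped Classical TensorProduct

namespace Summit.BirchSwinnertonDyer.BirchSwinnertonDyer.Cruxes.ResidualThetaCountLowerPureAtTwo.SideaK2G8

/-! ## §A. The `p = 2` collapse (proved) -/

section Collapse

variable {k : Type*} [CommRing k]

/-- **H1.** Over a ring with `2 = 0`, a `2 × 2` matrix with trace `0` and determinant `1` is an involution: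
Cayley–Hamilton `M² − tr(M)•M + det(M) = 0` reads `M² = −1 = 1`. -/
theorem mul_self_eq_one_of_trace_eq_zero_of_det_eq_one (h2 : (2 : k) = 0)
    (M : Matrix (Fin 2) (Fin 2) k) (htr : M.trace = 0) (hdet : M.det = 1) : M * M = 1 := by
  rw [Matrix.trace_fin_two] at htr
  rw [Matrix.det_fin_two] at hdet
  rw [Matrix.eta_fin_two M, Matrix.mul_fin_two, Matrix.one_fin_two]
  ext i j
  fin_cases i <;> fin_cases j
  · simp only [Matrix.of_apply, Matrix.cons_val', Matrix.cons_val_zero, Matrix.cons_val_fin_one,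
      Fin.zero_eta, Fin.isValue]
    linear_combination (M 0 0) * htr - hdet - h2
  · simp only [Matrix.of_apply, Matrix.cons_val', Matrix.cons_val_zero, Matrix.cons_val_one,
      Matrix.cons_val_fin_one, Fin.zero_eta, Fin.mk_one, Fin.isValue]
    linear_combination (M 0 1) * htr
  · simp only [Matrix.of_apply, Matrix.cons_val', Matrix.cons_val_zero, Matrix.cons_val_one,
      Matrix.cons_val_fin_one, Fin.zero_eta, Fin.mk_one, Fin.isValue]
    linear_combination (M 1 0) * htr
  · simp only [Matrix.of_apply, Matrix.cons_val', Matrix.cons_val_one, Matrix.cons_val_fin_one,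
      Fin.mk_one, Fin.isValue]
    linear_combination (M 1 1) * htr - hdet - h2

/-- **H1′.** Ideal version: `2 ∈ I`, `tr M ∈ I`, `det M − 1 ∈ I` ⟹ every entry of `M * M − 1` lies in `I`
(apply H1 over `k ⧸ I`). For `ρ_g(Frob_ℓ)` with `ā_ℓ = 0` and `det = ℓ` odd this is `ρ̄(Frob_ℓ)² = 1`. -/
theorem mul_self_sub_one_apply_mem (I : Ideal k) (h2 : (2 : k) ∈ I)
    (M : Matrix (Fin 2) (Fin 2) k) (htr : M.trace ∈ I) (hdet : M.det - 1 ∈ I) (i j : Fin 2) :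
    (M * M - 1 : Matrix (Fin 2) (Fin 2) k) i j ∈ I := by
  set f : k →+* k ⧸ I := Ideal.Quotient.mk I with hf
  have h2' : (2 : k ⧸ I) = 0 := by
    rw [show (2 : k ⧸ I) = f 2 from (map_ofNat f 2).symm, hf, Ideal.Quotient.eq_zero_iff_mem]
    exact h2
  have htr' : (M.map f).trace = 0 := by
    rw [Matrix.trace_fin_two] at htr ⊢
    simp only [Matrix.map_apply, ← map_add, hf, Ideal.Quotient.eq_zero_iff_mem]
    exact htr
  have hdet' : (M.map f).det = 1 := by
    have h := (Ideal.Quotient.eq (I := I)).2 hdet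
    rw [← hf, RingHom.map_det, RingHom.mapMatrix_apply, map_one] at h
    exact h
  have hsq := mul_self_eq_one_of_trace_eq_zero_of_det_eq_one h2' (M.map f) htr' hdet'
  have hmap : (M * M - 1).map f = 0 := by
    rw [Matrix.map_sub (⇑f) (map_sub f), Matrix.map_mul, hsq, Matrix.map_one (⇑f) (map_zero f) (map_one f),
      sub_self]
  have hij := congrFun (congrFun hmap i) j
  rw [Matrix.map_apply, Matrix.zero_apply, hf, Ideal.Quotient.eq_zero_iff_mem] at hij
  exact hij

/-- **H1″.** Iterated squaring: if every entry of `M * M − 1` lies in `I` and `2 ∈ I`, then for every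
`R ≥ 1` every entry of `M ^ (2 ^ R) − 1` lies in `I ^ R` (`(1 + N)² − 1 = 2N + N²`). Consequence used by
the card: on `A_ρ[ϖ^m]` the Frobenius power `φ ^ (2 ^ R)` acts trivially once `R ≥ m` (and likewise the
scalar `ℓ ^ (2 ^ R)`, the `1 × 1` case), so the UTD fixed-point count is the whole module. -/
theorem pow_two_pow_sub_one_apply_mem (I : Ideal k) (h2 : (2 : k) ∈ I)
    (M : Matrix (Fin 2) (Fin 2) k) (hM : ∀ i j, (M * M - 1 : Matrix (Fin 2) (Fin 2) k) i j ∈ I) :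
    ∀ R : ℕ, 1 ≤ R → ∀ i j, (M ^ (2 ^ R) - 1 : Matrix (Fin 2) (Fin 2) k) i j ∈ I ^ R := by
  intro R hR
  induction R, hR using Nat.le_induction with
  | base =>
    intro i j
    simpa [pow_one, pow_two] using hM i j
  | succ R hR ih =>
    intro i j
    set N : Matrix (Fin 2) (Fin 2) k := M ^ (2 ^ R) - 1 with hN
    have hpow : M ^ (2 ^ (R + 1)) = (1 + N) * (1 + N) := by
      rw [pow_succ, pow_mul, pow_two, hN, add_sub_cancel]
    have hexp : M ^ (2 ^ (R + 1)) - 1 = N + N + N * N := by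
      rw [hpow]; noncomm_ring
    rw [hexp, Matrix.add_apply, Matrix.add_apply, Matrix.mul_apply]
    refine Ideal.add_mem _ ?_ ?_
    · -- `N i j + N i j = 2 * N i j ∈ I * I ^ R = I ^ (R + 1)`
      rw [← two_mul, pow_succ']
      exact Ideal.mul_mem_mul h2 (ih i j)
    · -- `∑ l, N i l * N l j ∈ I ^ R * I ^ R = I ^ (2R) ≤ I ^ (R + 1)`
      refine Ideal.sum_mem _ fun l _ ↦ ?_
      have hmem : N i l * N l j ∈ I ^ (R + R) := by
        rw [pow_add]
        exact Ideal.mul_mem_mul (ih i l) (ih l j)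
      exact Ideal.pow_le_pow_right (by omega) hmem

/-- **H1‴ (scalar twin).** `ℓ` odd ⟹ `ℓ ^ (2 ^ R) ≡ 1 mod I ^ R` whenever `2 ∈ I` and `ℓ − 1 ∈ I`... stated
for any `u` with `u * u − 1 ∈ I` (e.g. `u = ℓ`, `ℓ² − 1 ∈ 8ℤ ⊆ I`). -/
theorem pow_two_pow_sub_one_mem (I : Ideal k) (h2 : (2 : k) ∈ I) (u : k) (hu : u * u - 1 ∈ I) :
    ∀ R : ℕ, 1 ≤ R → u ^ (2 ^ R) - 1 ∈ I ^ R := by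
  intro R hR
  induction R, hR using Nat.le_induction with
  | base => simpa [pow_one, pow_two] using hu
  | succ R hR ih =>
    set n : k := u ^ (2 ^ R) - 1 with hn
    have hexp : u ^ (2 ^ (R + 1)) - 1 = 2 * n + n * n := by
      rw [pow_succ, pow_mul, pow_two]
      have : u ^ (2 ^ R) = 1 + n := by rw [hn]; ring
      rw [this]; ring
    rw [hexp]
    refine Ideal.add_mem _ ?_ ?_
    · rw [pow_succ']
      exact Ideal.mul_mem_mul h2 ih
    · have hmem : n * n ∈ I ^ (R + R) := by
        rw [pow_add]; exact Ideal.mul_mem_mul ih ih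
      exact Ideal.pow_le_pow_right (by omega) hmem

end Collapse

/-! ## §B. Helper statements H2–H5 (typed signatures; `Prop`s, nothing asserted) -/

section Signatures

open Literature.NumberTheory.EllipticCurves Literature.NumberTheory.EllipticCurves.GreenbergSelmer
open Literature.NumberTheory.GaloisRepresentations NumberField IsDedekindDomain Field
open Rat.HeightOneSpectrum
open Summit.BirchSwinnertonDyer.Rank1Residual.X11b.Coinv (kerD)

/-- **H2 (triviality at an even-trace place; signature).** For `κ` the cyclotomic `ℤ₂`-extension of `ℚ`,
`ρ : Γ_ℚ → GL₂(𝒪)` unramified at `v ∤ 2` with Frobenius characteristic polynomial `X² − aX + ℓ`,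
`‖a‖ < 1`: the local group `ker κ ∩ D_v` (`kerD κ v`, = `Gal(ℚ̄_ℓ/ℚ_{∞,η})`) acts TRIVIALLY on
`A_ρ = Cofree ρ F`. Mechanism: H1′/H1″ (`ρ̄(Frob)² = 1`, so the closed procyclic group `⟨ρ(Frob)⟩` is
pro-2) + `D_v/I_v ∩ ker κ` is pro-prime-to-2 (UTD `coprime_index_of_quotient_localSubgroup_absInertia`,
`exists_forall_localSubgroup_le_iff_pow_mem`). -/
def LocalTrivialityAtEvenTracePlace : Prop :=
  ∀ (S : Set (PadicAlgCl 2)) (κ : ZpExtension ℚ 2), κ.IsCyclotomic →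
  ∀ (ρ : FramedGaloisRep ℚ ↥(padicCoeffIntegers S) 2) (v : HeightOneSpectrum (𝓞 ℚ)),
    ((2 : ℕ) : 𝓞 ℚ) ∉ v.asIdeal → ρ.IsUnramifiedAt v →
    (∃ (a : PadicAlgCl 2) (P : Polynomial ↥(padicCoeffIntegers S)), ‖a‖ < 1 ∧
        P.map (padicCoeffIntegers S).subtype =
          Polynomial.X ^ 2 - Polynomial.C a * Polynomial.X + Polynomial.C ((natGenerator v : ℕ) : PadicAlgCl 2) ∧
        ρ.HasFrobCharpolyAt v P) →
    ∀ σ : ↥(decomp (K := ℚ) v), σ ∈ kerD κ v →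
      ∀ m : Cofree ρ ↥(padicCoeffField S), (σ : absoluteGaloisGroup ℚ) • m = m

/-- **H3 (the local count at an even-trace place; signature).** Under the hypotheses of H2 and for an
irreducible `ϖ ∈ 𝒪`: `#H¹(ℚ_{∞,η}, A_ρ)[ϖ^m] = (#𝒪/ϖ)^{2m}` for every `m` — i.e. `H¹(ℚ_{∞,η}, A_ρ)` has
`𝒪`-corank `2 = d_{g,ℓ}` (Matsuno 2008 Lemma 2.4 "`1 + ε⁺ = 2`" transferred from `E` to `g`; Greenberg–Vatsal
2000 Prop. 2.4 at `p = 2`). Route: UTD `exists_forall_natCard_subgroupH1_localSubgroup_eq` with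
`B := A_ρ[2^k]` (`finite_torsionBy_cofree_pow`), whose fixed set is everything by H1″, then Kummer (H2 ⟹
`A_ρ^{H} = A_ρ` divisible ⟹ `H¹(H, A[2^k]) = H¹(H, A)[2^k]`). -/
def LocalCountAtEvenTracePlace : Prop :=
  ∀ (S : Set (PadicAlgCl 2)) [FiniteDimensional ℚ_[2] ↥(padicCoeffField S)]
    (κ : ZpExtension ℚ 2), κ.IsCyclotomic →
  ∀ (ρ : FramedGaloisRep ℚ ↥(padicCoeffIntegers S) 2) (v : HeightOneSpectrum (𝓞 ℚ)),
    ((2 : ℕ) : 𝓞 ℚ) ∉ v.asIdeal → ρ.IsUnramifiedAt v →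
    (∃ (a : PadicAlgCl 2) (P : Polynomial ↥(padicCoeffIntegers S)), ‖a‖ < 1 ∧
        P.map (padicCoeffIntegers S).subtype =
          Polynomial.X ^ 2 - Polynomial.C a * Polynomial.X + Polynomial.C ((natGenerator v : ℕ) : PadicAlgCl 2) ∧
        ρ.HasFrobCharpolyAt v P) →
    ∀ (ϖ : ↥(padicCoeffIntegers S)), Irreducible ϖ → ∀ m : ℕ,
      Nat.card {y : subgroupH1 (kerD κ v) (Cofree ρ ↥(padicCoeffField S)) //
          scalarH1 (kerD κ v) (Cofree ρ ↥(padicCoeffField S)) (ϖ ^ m) y = 0} =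
        Nat.card (↥(padicCoeffIntegers S) ⧸ Ideal.span {ϖ}) ^ (2 * m)

/-- **H3′ (finiteness at EVERY place `w ∤ 2`, incl. `w ∣ M` and odd-trace places; signature).**
`H¹(ℚ_{∞,η}, A_ρ)[ϖ]` is finite — the `[Module.Finite 𝒪 PS0]` binder of S1⊕ via co-Nakayama
(`module_finite_characterModule_of_finite_scalarH1_torsion` pattern, p665052). Route: UTD
`natCard_subgroupH1_localSubgroup_eq_natCard_invariants` + `natCard_continuousCohomology_one_absInertia_eq_natCard_invariants`
on `B := A_ρ[2^k]` + Kummer. -/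
def LocalTorsionFiniteAwayTwo : Prop :=
  ∀ (S : Set (PadicAlgCl 2)) [FiniteDimensional ℚ_[2] ↥(padicCoeffField S)]
    (κ : ZpExtension ℚ 2), κ.IsCyclotomic →
  ∀ (ρ : FramedGaloisRep ℚ ↥(padicCoeffIntegers S) 2) (v : HeightOneSpectrum (𝓞 ℚ)),
    ((2 : ℕ) : 𝓞 ℚ) ∉ v.asIdeal →
    ∀ (ϖ : ↥(padicCoeffIntegers S)), Irreducible ϖ →
      Finite {y : subgroupH1 (kerD κ v) (Cofree ρ ↥(padicCoeffField S)) //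
          scalarH1 (kerD κ v) (Cofree ρ ↥(padicCoeffField S)) ϖ y = 0}

/-- **H4 (currency: torsion counts ⟹ corank lower bound; signature).** For a `ϖ`-primary `𝒪`-module `D`
whose character module is finitely generated: `(#𝒪/ϖ)^{r m} ≤ #D[ϖ^m]` for all `m` forces
`r ≤ finrank_K (K ⊗_𝒪 D⋆)` (structure theorem over the DVR `𝒪`; the ℤ_p-twin is the tree's
`natCard_torsionBy_eq_pow_zpCorank_of_divisible` / UTD `zpCorank_*`). This is what converts H3 into
S1⊕'s `(count)` clause in the currency of `cmLambdaLower_of_finrank_characterModule`. -/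
def CorankCurrency : Prop :=
  ∀ (S : Set (PadicAlgCl 2)) (K : Type) [Field K] [Algebra ↥(padicCoeffIntegers S) K]
    [IsFractionRing ↥(padicCoeffIntegers S) K]
    (D : Type) [AddCommGroup D] [Module ↥(padicCoeffIntegers S) D]
    (ϖ : ↥(padicCoeffIntegers S)), Irreducible ϖ → (∀ x : D, ∃ n : ℕ, ϖ ^ n • x = 0) →
    Module.Finite ↥(padicCoeffIntegers S) (CharacterModule D) →
    ∀ r : ℕ, (∀ m : ℕ, Nat.card (↥(padicCoeffIntegers S) ⧸ Ideal.span {ϖ}) ^ (r * m) ≤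
        Nat.card {x : D // ϖ ^ m • x = 0}) →
      r ≤ Module.finrank K (K ⊗[↥(padicCoeffIntegers S)] CharacterModule D)

/-- **H5 (place-orbit count; signature).** The number of places of `ℚ_∞` (cyclotomic `ℤ₂`-extension) above
an odd prime `ℓ` is `2 ^ v₂((ℓ² − 1)/8)` = the index of the decomposition group `κ(D_v)·closure` in `Γ`;
typed as: the index of the closure of the image of `decomp v` under `κ` equals that power of `2`
(`ZpExtension` is onto `ℤ₂`; the image of `Frob_ℓ` is `⟨ℓ⟩ ⊂ ℤ₂^×/±1 ≅ 1 + 8ℤ₂`). -/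
def PlaceOrbitCountAtTwo : Prop :=
  ∀ (κ : ZpExtension ℚ 2), κ.IsCyclotomic → ∀ (v : HeightOneSpectrum (𝓞 ℚ)),
    ((2 : ℕ) : 𝓞 ℚ) ∉ v.asIdeal →
    (((decomp (K := ℚ) v).map κ.toContinuousMonoidHom.toMonoidHom).topologicalClosure).index =
      2 ^ padicValNat 2 ((natGenerator v ^ 2 - 1) / 8)

end Signatures

end Summit.BirchSwinnertonDyer.BirchSwinnertonDyer.Cruxes.ResidualThetaCountLowerPureAtTwo.SideaK2G8

end
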